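import Summits.CriticalPhenomena.PercolationContinuityZ3.Theorems.FK.OSSSWiredBoxRusso
import Summits.CriticalPhenomena.PercolationContinuityZ3.Theorems.FK.EdgeDensityLipschitz
import Summits.CriticalPhenomena.PercolationContinuityZ3.Theorems.FK.CriticalPointBounds
import Summits.CriticalPhenomena.PercolationContinuityZ3.Theorems.FK.InfiniteVolumeDLR
import Summits.CriticalPhenomena.PercolationContinuityZ3.Theorems.FK.InfiniteVolumeMeasures
import Literature.Probability.Percolation.DRTSharpnessLemma
import HarnessLib

/-!
# SHARPNESS OF THE RANDOM-CLUSTER PHASE TRANSITION ON `ℤ^d` BY DECISION TREES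
# (Duminil-Copin–Raoufi–Tassion 2019, Thm 1.2): exponential decay of `φ¹_{p,q}(0 ↔ ∂Λ_n)` for `p < p_c(q)` and the
# mean-field bound `θ¹(p,q) ≥ c (p − p_c(q))` for `p > p_c(q)`, all `q ≥ 1`, `d ≥ 2`

Claimed R42 (8)(c) in the cell INBOX at 2026-08-28T02:11:55Z by fkp-10a gen 352 (NEW CLAIM #2 of the gen), addressed to coordinator fk-4 g266 (seated 01:27Z 2026-08-28; R146 l.8252: row FO-10a-g352 = package g352-osss; its (κ) clause sends the FK instantiation to a new claim, R147); lineage row FO-10a-g352f (self-suggested), package g352-fkosss, label FS-G.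
Support file of the `fk-continuity` cell (lineage fkp-10a, `--supports stmt-CriticalPhenomena-4575`); builds on
p205010 (kernel theorem, internal audit signed; external expert review pending).  No definitions, no named facts,
no sorries; standard axioms.  Package `g352-fkosss` = THE FK INSTANTIATION of the OSSS inequality for monotonic measures
(row FO-10a-g352 `g352-osss`): Duminil-Copin–Raoufi–Tassion's Theorem 1.2 (sharpness of the random-cluster phase
transition on `ℤ^d`, `q ≥ 1`) and, on `ℤ²`, `p_c(q) = √q/(1+√q)`.  UNCONDITIONAL; nothing here touches FH / TP_FK / the
`_r3` binders of the cell.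

THE ASSEMBLY.  With `θ_n(p) = φ¹_{Λ_{2n},p,q}(0 ↔ ∂Λ_n)` (read at `p` projected to `[0,1]`), the OSSS differential inequality
`n θ_n(1 − θ_n) ≤ 8 p(1−p) S_n θ_n'` of `OSSSWiredBoxRusso.lean` (monotonic OSSS `g352-osss` + revealment sums + Russo) is put in
the division-free form `c₀ n θ_n ≤ S_n θ_n'` on `(α, β₁) ⊂ (0,1)` with `c₀ = (1 − θ_1(β₁))/2 > 0` (`θ_n ≤ θ_1 < 1`,
`4p(1−p) ≤ 1`), and fed into the Literature's analytic lemma `DRTLemma.drt_lemma` (DRT Lemma 3.1; continuity in `p` from the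
lineage's Lipschitz bound `abs_rcMeasure_real_sub_le_mul`, `θ_0 = 1`, `n ↦ θ_n` antitone).  The threshold `β̃(α, β₁)` it
produces is identified with `p_c(q)` (`rcCriticalProb d q`): below it `θ¹ ≤ θ_n → 0`, above it
`θ¹ = inf_m φ¹_{Λ_m}(0 ↔ ∂Λ_m) ≥ inf_m θ_m ≥ c₀(β − β̃) > 0`.  CONCLUSIONS (`d ≥ 2`, `q ≥ 1`):
* `exists_exp_decay_wiredBox_of_lt_rcCriticalProb` — for `0 < p < p_c(q)`: `∃ c > 0, ∀ n ≥ 1, φ¹_{Λ_{2n},p,q}(0 ↔ ∂Λ_n) ≤ e^{−cn}`;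
* **`FKGibbs.exists_exp_decay_real_siteToBoundary_of_lt_rcCriticalProb`** — for EVERY FK-Gibbs measure `P` at `(p,q)` with
  `0 ≤ p < p_c(q)` (in particular `φ⁰_{p,q}`, `φ¹_{p,q}`): `∃ c > 0, ∀ n ≥ 1, P(0 ↔ ∂Λ_n) ≤ e^{−cn}` — **Grimmett's Conjecture
  (5.54) (exponential decay) / DRT Thm 1.2 (1)**; `rcLimit_exists_exp_decay_real_siteToBoundary_of_lt_rcCriticalProb` (both `φ^b`);
* **`exists_pos_forall_thetaWired_ge_mul_sub`** — for every `p₁ < 1`: `∃ c > 0, ∀ p ∈ (p_c(q), p₁], θ¹(p,q) ≥ c (p − p_c(q))`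
  — **DRT Thm 1.2 (2), the mean-field bound `β ≤ 1`**.
No definitions; finite boxes and the lineage's `rcLimit` / `thetaWired` / `rcCriticalProb` only.

## References
* H. Duminil-Copin, A. Raoufi, V. Tassion, *Sharp phase transition for the random-cluster and Potts models via decision
  trees*, Ann. of Math. 189 (2019) 75–99, Thm 1.2, §3. [DuminilCopinRaoufiTassion2019]
* G. Grimmett, *The Random-Cluster Model*, Springer 2006, Conj. (5.54) (exponential decay), Thm (5.33), §5.1 (5.1)–(5.4). [Grimmett2006]
-/

noncomputable section

namespace Summit.CriticalPhenomena.PercolationContinuityZ3.Theorems.FK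

namespace MonotonicOSSS

open MeasureTheory Finset Function Filter Topology Set
open Literature.Probability.Percolation Literature.Probability.LatticeModels Literature.Barriers.CriticalPhenomena
open Literature.Probability.Percolation.OneArmOSSS Literature.Probability.Percolation.DCT16
open Literature.Probability.Percolation.DRTLemma
open Classical

variable {d : ℕ} {q : ℝ}

/-! ### The family `θ_n(x) = φ¹_{Λ_{2n}, π(x), q}(0 ↔ ∂Λ_n)`, `π(x) = min 1 (max 0 x)` -/

/-- `π(x) = min 1 (max 0 x) ∈ [0,1]`. [folklore] -/
theorem proj_mem_Icc (x : ℝ) : min 1 (max 0 x) ∈ Set.Icc (0 : ℝ) 1 :=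
  ⟨le_min zero_le_one (le_max_left _ _), min_le_left _ _⟩

/-- `π(x) = x` on `[0,1]`. [folklore] -/
theorem proj_eq_self {x : ℝ} (hx : x ∈ Set.Icc (0 : ℝ) 1) : min 1 (max 0 x) = x := by
  rw [max_eq_right hx.1, min_eq_right hx.2]

/-- `π` is monotone. [folklore] -/
theorem proj_mono : Monotone fun x : ℝ => min 1 (max 0 x) :=
  fun _ _ h => min_le_min le_rfl (max_le_max le_rfl h)

/-- `π` is continuous. [folklore] -/
theorem continuous_proj : Continuous fun x : ℝ => min 1 (max 0 x) :=
  continuous_const.min (continuous_const.max continuous_id)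

/-- `0 ↔ ∂Λ_0` holds for every configuration (`d ≥ 1`: the origin is its own box boundary). [folklore] -/
theorem mem_siteToBoundary_zero (hd : 1 ≤ d) (ω : BondConfig (Site d)) : ω ∈ siteToBoundary d 0 := by
  have h0 : (0 : Site d) ∈ innerBoundary (zdGraph d) (box d 0) := by
    rw [mem_innerBoundary_iff]
    refine ⟨zero_mem_box d 0, 0 + Pi.single ⟨0, hd⟩ 1, fun h => ?_,
      (zdGraph_adj_iff _ _).2 ⟨⟨0, hd⟩, Or.inl rfl⟩⟩
    have := (mem_box.1 h ⟨0, hd⟩).2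
    simp at this
  rw [mem_siteToBoundary_iff]
  exact ⟨0, h0, PathIn.refl (zero_mem_box d 0)⟩

/-- `θ_0 = φ¹_{Λ_0}(0 ↔ ∂Λ_0) = 1` (`d ≥ 1`). [cite: DuminilCopinRaoufiTassion2019, §3 proof of Thm 1.2 (θ_0 = 1)] -/
theorem thetaBox_zero (hd : 1 ≤ d) {p : ℝ} (hp : p ∈ Set.Icc (0 : ℝ) 1) (hq : 0 < q) :
    regionWiredReal d p q (box d (2 * 0)) (siteToBoundary d 0) = 1 := by
  rw [show siteToBoundary d 0 = Set.univ from Set.eq_univ_of_forall (mem_siteToBoundary_zero hd)]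
  exact regionWiredReal_univ d hp hq _

/-- `θ_1(p) = φ¹_{Λ_2,p,q}(0 ↔ ∂Λ_1) < 1` for `p < 1` (the empty configuration has positive weight and no arm).
[cite: Grimmett2006, §1.2 eq. (1.2) (positive weights)] -/
theorem thetaBox_one_lt_one {p : ℝ} (hp : p ∈ Set.Ioo (0 : ℝ) 1) (hq : 0 < q) :
    regionWiredReal d p q (box d (2 * 1)) (siteToBoundary d 1) < 1 := by
  have hpI : p ∈ Set.Icc (0 : ℝ) 1 := ⟨hp.1.le, hp.2.le⟩
  set G := finsetGraph (zdGraph d) (box d (2 * 1))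
  set B := wiredBoundary (zdGraph d) (box d (2 * 1))
  haveI := isProbabilityMeasure_rcMeasure G hpI hq B
  have hpos : 0 < (rcMeasure G p q B).real (liftEdges (box d (2 * 1)) ⁻¹' (siteToBoundary d 1)ᶜ) := by
    refine rcMeasure_real_pos_of_coe_mem G hp hq B (ω₀ := ∅) (Finset.empty_subset _) ?_
    rw [Set.mem_preimage, Set.mem_compl_iff]
    have hempty : liftEdges (box d (2 * 1)) (↑(∅ : Finset (Sym2 ↥(box d (2 * 1)))) : BondConfig ↥(box d (2 * 1))) = ∅ := by
      rw [Finset.coe_empty, liftEdges, Set.image_empty]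
    rw [hempty]
    exact not_mem_siteToBoundary_one (Set.empty_subset _) (fun u _ h => h)
  have hsum : (rcMeasure G p q B).real (liftEdges (box d (2 * 1)) ⁻¹' siteToBoundary d 1)
      + (rcMeasure G p q B).real (liftEdges (box d (2 * 1)) ⁻¹' (siteToBoundary d 1)ᶜ) = 1 := by
    rw [Set.preimage_compl, measureReal_add_measureReal_compl
      ((measurable_of_finite (liftEdges (box d (2 * 1)))) (measurableSet_siteToBoundary d 1)), probReal_univ]
  rw [regionWiredReal]
  linarith

/-- `θ_n(x) ≤ θ_1(β₁)` for `n ≥ 1` and `x ≤ β₁` (`x, β₁ ∈ [0,1]`): antitone in `n`, nondecreasing in `p`.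
[cite: DuminilCopinRaoufiTassion2019, §3 proof of Thm 1.2 ("we used that θ_n ≤ θ_1 … and β ≤ β_0")] -/
theorem thetaBox_le_thetaBox_one (hd : 1 ≤ d) (hq : 1 ≤ q) {x β₁ : ℝ} (hx : x ∈ Set.Icc (0 : ℝ) 1)
    (hβ₁ : β₁ ∈ Set.Icc (0 : ℝ) 1) (hxβ : x ≤ β₁) {n : ℕ} (hn : 1 ≤ n) :
    regionWiredReal d x q (box d (2 * n)) (siteToBoundary d n) ≤ regionWiredReal d β₁ q (box d (2 * 1)) (siteToBoundary d 1) :=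
  (theta_box_antitone hd hx hq hn).trans (regionWiredReal_siteToBoundary_mono_left hx hβ₁ hxβ hq _ _)

/-- CONTINUITY IN `p` of `x ↦ φ¹_{Λ,π(x),q}(A)` (Lipschitz on `[0,1]`, Grimmett Thm (2.43); composed with the projection).
[cite: Grimmett2006, Thm (2.43) eq. (2.44)–(2.45)] -/
theorem continuous_regionWiredReal_proj (hq : 1 ≤ q) (Λ : Finset (Site d)) (A : Set (BondConfig (Site d))) :
    Continuous fun x : ℝ => regionWiredReal d (min 1 (max 0 x)) q Λ A := by
  set G := finsetGraph (zdGraph d) Λ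
  set B := wiredBoundary (zdGraph d) Λ
  have hlip := LipschitzOnWith.of_dist_le' (K := q * #G.edgeFinset) (s := Set.Icc (0 : ℝ) 1)
      (f := fun p : ℝ => (rcMeasure G p q B).real (liftEdges Λ ⁻¹' A)) (fun x hx y hy => by
    rw [Real.dist_eq, Real.dist_eq]
    exact abs_rcMeasure_real_sub_le_mul G hq B _ hy hx)
  have hcont : ContinuousOn (fun p : ℝ => (rcMeasure G p q B).real (liftEdges Λ ⁻¹' A)) (Set.Icc (0 : ℝ) 1) :=
    hlip.continuousOn
  exact hcont.comp_continuous continuous_proj proj_mem_Icc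

/-- DIFFERENTIABILITY AND THE DERIVATIVE of `θ_n ∘ π` at an interior point: it is the derivative `D` of
`OSSSWiredBoxRusso.wiredBox_oneArm_hasDerivAt_ge`. [cite: Grimmett2006, Thm (2.43) (differentiability in p)] -/
theorem hasDerivAt_thetaBox_proj {p : ℝ} (hp : p ∈ Set.Ioo (0 : ℝ) 1) (n : ℕ) {D : ℝ}
    (hD : HasDerivAt (fun r => regionWiredReal d r q (box d (2 * n)) (siteToBoundary d n)) D p) :
    HasDerivAt (fun x => regionWiredReal d (min 1 (max 0 x)) q (box d (2 * n)) (siteToBoundary d n)) D p := by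
  refine hD.congr_of_eventuallyEq ?_
  filter_upwards [Ioo_mem_nhds hp.1 hp.2] with x hx
  rw [proj_eq_self ⟨hx.1.le, hx.2.le⟩]

/-! ### The hypotheses of DRT's Lemma 3.1 and the threshold -/

/-- **THE DIVISION-FREE OSSS INEQUALITY WITH A UNIFORM CONSTANT**: for `d ≥ 1`, `q ≥ 1`, `n ≥ 1`, `0 < x ≤ β₁ < 1`:
`((1 − θ_1(β₁))/2) · n · θ_n(x) ≤ S_n(x) · θ_n'(x)` (from `n θ_n(1−θ_n) ≤ 8 x(1−x) S_n θ_n'`, `4x(1−x) ≤ 1`,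
`1 − θ_n(x) ≥ 1 − θ_1(β₁)`). [cite: DuminilCopinRaoufiTassion2019, §3 eq. (3.4) (θ_n' ≥ c (n/S_n) θ_n with c = c(β_0))] -/
theorem const_mul_thetaBox_le_psum_mul_deriv (hd : 1 ≤ d) (hq : 1 ≤ q) {β₁ : ℝ} (hβ₁ : β₁ < 1) {n : ℕ} (hn : 1 ≤ n)
    {x : ℝ} (hx0 : 0 < x) (hxβ : x ≤ β₁) :
    (1 - regionWiredReal d β₁ q (box d (2 * 1)) (siteToBoundary d 1)) / 2 * n
        * regionWiredReal d (min 1 (max 0 x)) q (box d (2 * n)) (siteToBoundary d n)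
      ≤ psum (fun k y => regionWiredReal d (min 1 (max 0 y)) q (box d (2 * k)) (siteToBoundary d k)) n x
        * deriv (fun y => regionWiredReal d (min 1 (max 0 y)) q (box d (2 * n)) (siteToBoundary d n)) x := by
  have hx1 : x < 1 := lt_of_le_of_lt hxβ hβ₁
  have hx : x ∈ Set.Ioo (0 : ℝ) 1 := ⟨hx0, hx1⟩
  have hxI : x ∈ Set.Icc (0 : ℝ) 1 := ⟨hx0.le, hx1.le⟩
  have hβI : β₁ ∈ Set.Icc (0 : ℝ) 1 := ⟨hx0.le.trans hxβ, hβ₁.le⟩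
  obtain ⟨D, hD, hD0, hineq⟩ := wiredBox_oneArm_hasDerivAt_ge hd hx hq hn
  rw [(hasDerivAt_thetaBox_proj hx n hD).deriv, psum]
  simp only [proj_eq_self hxI]
  set θ := regionWiredReal d x q (box d (2 * n)) (siteToBoundary d n) with hθ
  set S := ∑ k ∈ Finset.range n, regionWiredReal d x q (box d (2 * k)) (siteToBoundary d k) with hS
  set t := regionWiredReal d β₁ q (box d (2 * 1)) (siteToBoundary d 1) with ht
  have hθt : θ ≤ t := thetaBox_le_thetaBox_one hd hq hxI hβI hxβ hn
  have hθ0 : 0 ≤ θ := measureReal_nonneg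
  have hS0 : 0 ≤ S := Finset.sum_nonneg fun k _ => measureReal_nonneg
  have h4 : 4 * (x * (1 - x)) ≤ 1 := by nlinarith [sq_nonneg (2 * x - 1)]
  have hSD : 0 ≤ S * D := mul_nonneg hS0 hD0
  -- `n θ (1 − t) ≤ n θ (1 − θ) ≤ 8 S x(1−x) D ≤ 2 S D`
  have h1 : (n : ℝ) * (θ * (1 - t)) ≤ (n : ℝ) * (θ * (1 - θ)) :=
    mul_le_mul_of_nonneg_left (mul_le_mul_of_nonneg_left (by linarith) hθ0) (Nat.cast_nonneg n)
  have h2 : 8 * S * (x * (1 - x)) * D ≤ 2 * (S * D) := by nlinarith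
  nlinarith [h1, h2, hineq]

/-- **THE THRESHOLD OF DRT's LEMMA 3.1 FOR `θ_n`** (`d ≥ 1`, `q ≥ 1`, `0 < α ≤ β₁ < 1`): there is `β̃ ∈ [α, β₁]` with
(P1) for `β ∈ [α, β̃)`: `∃ c > 0, ∀ n ≥ 1, θ_n(β) ≤ e^{−cn}`, and (P2) for `β ∈ (β̃, β₁]`: `∀ n, c₀(β − β̃) ≤ θ_n(β)`,
`c₀ = (1 − θ_1(β₁))/2`. [cite: DuminilCopinRaoufiTassion2019, §3 Lemma 3.1 applied to f_n = θ_n/c (proof of Thm 1.2)] -/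
theorem exists_threshold (hd : 1 ≤ d) (hq : 1 ≤ q) {α β₁ : ℝ} (hα : 0 < α) (hαβ : α ≤ β₁) (hβ₁ : β₁ < 1) :
    ∃ βc ∈ Set.Icc α β₁,
      (∀ β ∈ Set.Ico α βc, ∃ c : ℝ, 0 < c ∧ ∀ n, 1 ≤ n →
        regionWiredReal d (min 1 (max 0 β)) q (box d (2 * n)) (siteToBoundary d n) ≤ 1 * Real.exp (-(c * n))) ∧
      (∀ β ∈ Set.Ioc βc β₁, ∀ n,
        (1 - regionWiredReal d β₁ q (box d (2 * 1)) (siteToBoundary d 1)) / 2 * (β - βc)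
          ≤ regionWiredReal d (min 1 (max 0 β)) q (box d (2 * n)) (siteToBoundary d n)) := by
  have hq0 : 0 < q := one_pos.trans_le hq
  have hβI : β₁ ∈ Set.Ioo (0 : ℝ) 1 := ⟨hα.trans_le hαβ, hβ₁⟩
  have hc₀ : 0 < (1 - regionWiredReal d β₁ q (box d (2 * 1)) (siteToBoundary d 1)) / 2 := by
    have := thetaBox_one_lt_one (d := d) hβI hq0; linarith
  exact drt_lemma (f := fun n x => regionWiredReal d (min 1 (max 0 x)) q (box d (2 * n)) (siteToBoundary d n))
    (M := 1) (m₀ := 1) hαβ one_pos one_pos hc₀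
    (fun n => continuous_regionWiredReal_proj hq _ _)
    (fun n x hx => by
      have hxI : x ∈ Set.Ioo (0 : ℝ) 1 := ⟨hα.trans hx.1, hx.2.trans hβ₁⟩
      rcases Nat.eq_zero_or_pos n with rfl | hn
      · have h1 : (fun y : ℝ => regionWiredReal d (min 1 (max 0 y)) q (box d (2 * 0)) (siteToBoundary d 0))
            = fun _ => (1 : ℝ) := funext fun y => thetaBox_zero hd (proj_mem_Icc y) hq0
        rw [h1]; exact differentiableAt_const _
      · obtain ⟨D, hD, -, -⟩ := wiredBox_oneArm_hasDerivAt_ge hd hxI hq hn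
        exact (hasDerivAt_thetaBox_proj hxI n hD).differentiableAt)
    (fun n x y hxy => regionWiredReal_siteToBoundary_mono_left (proj_mem_Icc x) (proj_mem_Icc y) (proj_mono hxy) hq _ _)
    (fun n x => measureReal_nonneg) (fun n x => regionWiredReal_le_one (proj_mem_Icc x) hq0 _ _)
    (fun x => (thetaBox_zero hd (proj_mem_Icc x) hq0).symm.le)
    (fun x => theta_box_antitone hd (proj_mem_Icc x) hq)
    (fun n hn x hx => const_mul_thetaBox_le_psum_mul_deriv hd hq hβ₁ hn (hα.trans hx.1) hx.2.le)

/-! ### The threshold is `p_c(q)` -/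

/-- `θ¹(p,q) ≤ θ_n(p) = φ¹_{Λ_{2n},p,q}(0 ↔ ∂Λ_n)`: `θ¹ = inf_m φ¹_{Λ_m}(0 ↔ ∂Λ_m) ≤ φ¹_{Λ_{2n}}(0 ↔ ∂Λ_{2n}) ≤ φ¹_{Λ_{2n}}(0 ↔ ∂Λ_n)`.
[cite: DuminilCopinRaoufiTassion2019, §3 proof of Thm 1.2 ("the comparison between boundary conditions gives θ_n ≥ θ")] -/
theorem thetaWired_le_thetaBox (hd : 1 ≤ d) {p : ℝ} (hp : p ∈ Set.Icc (0 : ℝ) 1) (hq : 1 ≤ q) (n : ℕ) :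
    thetaWired d p q ≤ regionWiredReal d p q (box d (2 * n)) (siteToBoundary d n) := by
  have hq0 : 0 < q := one_pos.trans_le hq
  calc thetaWired d p q ≤ thetaWiredBox d p q (2 * n) := thetaWired_le_thetaWiredBox' d hp hq _
    _ = regionWiredReal d p q (box d (2 * n)) (siteToBoundary d (2 * n)) := by
        rw [← rcBoxLaw_true_real_siteToBoundary_self, regionWiredReal_box p q _ (measurableSet_siteToBoundary d _)]
    _ = regionWiredReal d p q (box d (2 * n)) (armEvent 0 (2 * n)) := by rw [armEvent_zero]
    _ ≤ regionWiredReal d p q (box d (2 * n)) (armEvent 0 n) :=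
        regionWiredReal_armEvent_anti hd hp hq0 _ _ (by omega)
    _ = regionWiredReal d p q (box d (2 * n)) (siteToBoundary d n) := by rw [armEvent_zero]

/-- `θ_m(p) ≤ φ¹_{Λ_m,p,q}(0 ↔ ∂Λ_m)` (the wired measure of the smaller box dominates).
[cite: Grimmett2006, Thm (4.19)(a) proof eq. (4.24)] -/
theorem thetaBox_le_thetaWiredBox {p : ℝ} (hp : p ∈ Set.Icc (0 : ℝ) 1) (hq : 1 ≤ q) (m : ℕ) :
    regionWiredReal d p q (box d (2 * m)) (siteToBoundary d m) ≤ thetaWiredBox d p q m := by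
  rw [← rcBoxLaw_true_real_siteToBoundary_self, ← regionWiredReal_box p q _ (measurableSet_siteToBoundary d _)]
  exact regionWiredReal_box_siteToBoundary_anti hp hq le_rfl (by omega)

/-- A UNIFORM LOWER BOUND ON THE `θ_m(p)` BOUNDS `θ¹(p,q)` FROM BELOW (`θ¹ = lim_m φ¹_{Λ_m}(0 ↔ ∂Λ_m) ≥ inf θ_m`).
[cite: DuminilCopinRaoufiTassion2019, §3 proof of Thm 1.2 ("θ_n converges to θ")] -/
theorem le_thetaWired_of_forall_le_thetaBox {p : ℝ} (hp : p ∈ Set.Icc (0 : ℝ) 1) (hq : 1 ≤ q) {c : ℝ}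
    (h : ∀ m, c ≤ regionWiredReal d p q (box d (2 * m)) (siteToBoundary d m)) : c ≤ thetaWired d p q :=
  ge_of_tendsto' (tendsto_thetaWiredBox d hp hq) fun m => (h m).trans (thetaBox_le_thetaWiredBox hp hq m)

/-- **THE THRESHOLD IS `p_c(q)`**: for `d ≥ 1`, `q ≥ 1` and `0 < α < p_c(q) < β₁ < 1`, the threshold `β̃(α, β₁)` of Lemma 3.1
for `θ_n` equals `rcCriticalProb d q` — below it `θ¹ = 0` (so `β̃ ≤ p_c`), above it `θ¹ > 0` (so `β̃ ≥ p_c`).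
[cite: DuminilCopinRaoufiTassion2019, Thm 1.2 ("β_1 = β_c as soon as β_0 is chosen larger than β_c")] -/
theorem threshold_eq_rcCriticalProb (hd : 1 ≤ d) (hq : 1 ≤ q) {α β₁ : ℝ} (hα : 0 < α) (hαpc : α < rcCriticalProb d q)
    (hpcβ : rcCriticalProb d q < β₁) (hβ₁ : β₁ < 1) {βc : ℝ} (hβc : βc ∈ Set.Icc α β₁)
    (hP1 : ∀ β ∈ Set.Ico α βc, ∃ c : ℝ, 0 < c ∧ ∀ n, 1 ≤ n →
      regionWiredReal d (min 1 (max 0 β)) q (box d (2 * n)) (siteToBoundary d n) ≤ 1 * Real.exp (-(c * n)))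
    (hP2 : ∀ β ∈ Set.Ioc βc β₁, ∀ n,
      (1 - regionWiredReal d β₁ q (box d (2 * 1)) (siteToBoundary d 1)) / 2 * (β - βc)
        ≤ regionWiredReal d (min 1 (max 0 β)) q (box d (2 * n)) (siteToBoundary d n)) :
    βc = rcCriticalProb d q := by
  have hq0 : 0 < q := one_pos.trans_le hq
  have hβ₁I : β₁ ∈ Set.Ioo (0 : ℝ) 1 := ⟨hα.trans (hαpc.trans hpcβ), hβ₁⟩
  have hc0 : 0 < (1 - regionWiredReal d β₁ q (box d (2 * 1)) (siteToBoundary d 1)) / 2 := by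
    have := thetaBox_one_lt_one (d := d) hβ₁I hq0; linarith
  refine le_antisymm ?_ ?_
  · -- `βc ≤ p_c`: otherwise some `β ∈ (p_c, βc)` has exponential decay of `θ_n(β) ≥ θ¹(β) > 0`
    by_contra h
    push Not at h
    set β : ℝ := (max α (rcCriticalProb d q) + βc) / 2 with hβdef
    have hmax : max α (rcCriticalProb d q) < βc := max_lt (lt_of_lt_of_le hαpc h.le) h
    have hβ1 : max α (rcCriticalProb d q) < β := by rw [hβdef]; linarith
    have hβ2 : β < βc := by rw [hβdef]; linarith
    have hαβ : α ≤ β := (le_max_left _ _).trans hβ1.le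
    have hpcβ' : rcCriticalProb d q < β := lt_of_le_of_lt (le_max_right _ _) hβ1
    have hβI : β ∈ Set.Icc (0 : ℝ) 1 := ⟨by linarith, by linarith [hβc.2]⟩
    obtain ⟨c, hc, hdec⟩ := hP1 β ⟨hαβ, hβ2⟩
    have hpos : 0 < thetaWired d β q := thetaWired_pos_of_rcCriticalProb_lt hβI hpcβ'
    -- `θ¹(β) ≤ θ_n(β) ≤ e^{-cn} → 0`
    have hlim : Tendsto (fun n : ℕ => 1 * Real.exp (-(c * n))) atTop (𝓝 0) := by
      have h1 : Tendsto (fun n : ℕ => c * (n : ℝ)) atTop atTop := tendsto_natCast_atTop_atTop.const_mul_atTop hc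
      have h2 := Real.tendsto_exp_neg_atTop_nhds_zero.comp h1
      have h3 : (fun n : ℕ => 1 * Real.exp (-(c * n))) = ((fun x => Real.exp (-x)) ∘ fun n : ℕ => c * (n : ℝ)) := by
        ext n; simp [Function.comp]
      rw [h3]; exact h2
    have hle : thetaWired d β q ≤ 0 := by
      refine ge_of_tendsto' hlim fun n => ?_
      rcases Nat.eq_zero_or_pos n with rfl | hn
      · simp only [Nat.cast_zero, mul_zero, neg_zero, Real.exp_zero, mul_one]
        exact thetaWired_le_one d hβI hq0
      · have h1 := thetaWired_le_thetaBox hd hβI hq n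
        have h2 := hdec n hn
        rw [proj_eq_self hβI] at h2
        exact h1.trans h2
    linarith
  · -- `p_c ≤ βc`: otherwise some `β ∈ (βc, p_c)` has `θ¹(β) ≥ c₀ (β − βc) > 0`
    by_contra h
    push Not at h
    set β : ℝ := (βc + min (rcCriticalProb d q) β₁) / 2 with hβdef
    have hmin : βc < min (rcCriticalProb d q) β₁ := lt_min h (lt_of_lt_of_le h hpcβ.le)
    have hβ1 : βc < β := by rw [hβdef]; linarith
    have hβ2 : β < min (rcCriticalProb d q) β₁ := by rw [hβdef]; linarith
    have hβpc : β < rcCriticalProb d q := lt_of_lt_of_le hβ2 (min_le_left _ _)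
    have hββ₁ : β ≤ β₁ := hβ2.le.trans (min_le_right _ _)
    have hβI : β ∈ Set.Icc (0 : ℝ) 1 := ⟨by linarith [hβc.1], by linarith⟩
    have hge := le_thetaWired_of_forall_le_thetaBox (d := d) hβI hq
      (c := (1 - regionWiredReal d β₁ q (box d (2 * 1)) (siteToBoundary d 1)) / 2 * (β - βc)) (fun m => by
        have h2 := hP2 β ⟨hβ1, hββ₁⟩ m
        rwa [proj_eq_self hβI] at h2)
    have hpos : 0 < (1 - regionWiredReal d β₁ q (box d (2 * 1)) (siteToBoundary d 1)) / 2 * (β - βc) :=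
      mul_pos hc0 (by linarith)
    have hzero : thetaWired d β q = 0 := thetaWired_eq_zero_of_lt_rcCriticalProb hq hβI.1 hβpc
    linarith

/-! ### DRT's Theorem 1.2 for the random-cluster model on `ℤ^d` -/

/-- **SHARPNESS, FINITE-VOLUME FORM** (`d ≥ 2`, `q ≥ 1`): for every `0 < p < p_c(q)` there is `c > 0` with
`φ¹_{Λ_{2n},p,q}(0 ↔ ∂Λ_n) ≤ e^{−cn}` for all `n ≥ 1`. [cite: DuminilCopinRaoufiTassion2019, Thm 1.2 (1) and §3 ("φ^w_{Λ_{2n}}[0 ↔ ∂Λ_{2n}] ≤ θ_n")] -/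
theorem exists_exp_decay_thetaBox_of_lt_rcCriticalProb (hd : 2 ≤ d) (hq : 1 ≤ q) {p : ℝ} (hp0 : 0 < p)
    (hpc : p < rcCriticalProb d q) :
    ∃ c : ℝ, 0 < c ∧ ∀ n : ℕ, 1 ≤ n → regionWiredReal d p q (box d (2 * n)) (siteToBoundary d n) ≤ Real.exp (-(c * n)) := by
  have hd1 : 1 ≤ d := by omega
  have hpc1 : rcCriticalProb d q < 1 := rcCriticalProb_lt_one hd hq
  set β₁ : ℝ := (rcCriticalProb d q + 1) / 2 with hβ₁
  have hpcβ : rcCriticalProb d q < β₁ := by rw [hβ₁]; linarith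
  have hβ₁1 : β₁ < 1 := by rw [hβ₁]; linarith
  obtain ⟨βc, hβc, hP1, hP2⟩ := exists_threshold (d := d) (q := q) hd1 hq hp0 (by linarith) hβ₁1
  have heq := threshold_eq_rcCriticalProb hd1 hq hp0 hpc hpcβ hβ₁1 hβc hP1 hP2
  obtain ⟨c, hc, hdec⟩ := hP1 p ⟨le_rfl, by rw [heq]; exact hpc⟩
  have hpI : p ∈ Set.Icc (0 : ℝ) 1 := ⟨hp0.le, (hpc.trans hpc1).le⟩
  refine ⟨c, hc, fun n hn => ?_⟩
  have h := hdec n hn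
  rwa [proj_eq_self hpI, one_mul] at h

/-- **SHARPNESS OF THE RANDOM-CLUSTER PHASE TRANSITION (DRT Thm 1.2 (1); Grimmett's Conj. (5.54), exponential decay, in its
`0 ↔ ∂Λ_n` form)**: for `d ≥ 2`, `q ≥ 1`
and EVERY FK-Gibbs measure `P` at `(p,q)` with `0 ≤ p < p_c(q)` — in particular `φ⁰_{p,q}` and `φ¹_{p,q}` — the radius of the
cluster of the origin has an exponential tail: `∃ c > 0, ∀ n ≥ 1, P(0 ↔ ∂Λ_n) ≤ e^{−cn}`.
[cite: DuminilCopinRaoufiTassion2019, Thm 1.2 (1) (exponential decay of connectivity below p_c for the random-cluster model, q ≥ 1)] -/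
theorem FKGibbs.exists_exp_decay_real_siteToBoundary_of_lt_rcCriticalProb (hd : 2 ≤ d) (hq : 1 ≤ q) {p : ℝ}
    (hp0 : 0 ≤ p) (hpc : p < rcCriticalProb d q) {P : Measure (BondConfig (Site d))} (hP : FKGibbs d p q P) :
    ∃ c : ℝ, 0 < c ∧ ∀ n : ℕ, 1 ≤ n → P.real (siteToBoundary d n) ≤ Real.exp (-(c * n)) := by
  have hpc1 : rcCriticalProb d q < 1 := rcCriticalProb_lt_one hd hq
  have hpI : p ∈ Set.Icc (0 : ℝ) 1 := ⟨hp0, (hpc.trans hpc1).le⟩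
  -- a strictly positive parameter `p' ∈ [p, p_c)` to run the finite-volume statement at
  set p' : ℝ := (p + rcCriticalProb d q) / 2 with hp'
  have hp'0 : 0 < p' := by rw [hp']; linarith [rcCriticalProb_pos (by omega : 1 ≤ d) hq]
  have hp'c : p' < rcCriticalProb d q := by rw [hp']; linarith
  have hpp' : p ≤ p' := by rw [hp']; linarith
  have hp'I : p' ∈ Set.Icc (0 : ℝ) 1 := ⟨hp'0.le, (hp'c.trans hpc1).le⟩
  obtain ⟨c, hc, hdec⟩ := exists_exp_decay_thetaBox_of_lt_rcCriticalProb hd hq hp'0 hp'c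
  refine ⟨c, hc, fun n hn => ?_⟩
  calc P.real (siteToBoundary d n) ≤ regionWiredReal d p q (box d (2 * n)) (siteToBoundary d n) :=
        hP.real_siteToBoundary_le_regionWiredReal hpI hq (by omega)
    _ ≤ regionWiredReal d p' q (box d (2 * n)) (siteToBoundary d n) :=
        regionWiredReal_siteToBoundary_mono_left hpI hp'I hpp' hq _ _
    _ ≤ Real.exp (-(c * n)) := hdec n hn

/-- **SHARPNESS for the infinite-volume measures `φ^b_{p,q}`** (`b = 0` free, `b = 1` wired; `d ≥ 2`, `q ≥ 1`, `0 ≤ p < p_c(q)`):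
`∃ c > 0, ∀ n ≥ 1, φ^b_{p,q}(0 ↔ ∂Λ_n) ≤ e^{−cn}`. [cite: DuminilCopinRaoufiTassion2019, Thm 1.2 (1)] -/
theorem rcLimit_exists_exp_decay_real_siteToBoundary_of_lt_rcCriticalProb (hd : 2 ≤ d) (b : Bool) (hq : 1 ≤ q)
    {p : ℝ} (hp0 : 0 ≤ p) (hpc : p < rcCriticalProb d q) :
    ∃ c : ℝ, 0 < c ∧ ∀ n : ℕ, 1 ≤ n → (rcLimit d b p q).real (siteToBoundary d n) ≤ Real.exp (-(c * n)) := by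
  have hpI : p ∈ Set.Icc (0 : ℝ) 1 := ⟨hp0, (hpc.trans (rcCriticalProb_lt_one hd hq)).le⟩
  exact FKGibbs.exists_exp_decay_real_siteToBoundary_of_lt_rcCriticalProb hd hq hp0 hpc
    ((isBoxLimit_rcLimit b hpI hq).fkGibbs hpI hq)

/-- **THE MEAN-FIELD BOUND (DRT Thm 1.2 (2))**: for `d ≥ 2`, `q ≥ 1` and every `p₁ ∈ (p_c(q), 1)` there is `c > 0`
(`c = (1 − φ¹_{Λ_2,p₁,q}(0 ↔ ∂Λ_1))/2`) with `θ¹(p,q) ≥ c·(p − p_c(q))` for all `p ∈ (p_c(q), p₁]`.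
[cite: DuminilCopinRaoufiTassion2019, Thm 1.2 (2) (θ(p) ≥ c(p − p_c) for the random-cluster model)] -/
theorem exists_pos_forall_thetaWired_ge_mul_sub (hd : 2 ≤ d) (hq : 1 ≤ q) {p₁ : ℝ} (hpc : rcCriticalProb d q < p₁)
    (hp₁ : p₁ < 1) :
    ∃ c : ℝ, 0 < c ∧ ∀ p ∈ Set.Ioc (rcCriticalProb d q) p₁, c * (p - rcCriticalProb d q) ≤ thetaWired d p q := by
  have hd1 : 1 ≤ d := by omega
  have hq0 : 0 < q := one_pos.trans_le hq
  have hpc0 : 0 < rcCriticalProb d q := rcCriticalProb_pos hd1 hq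
  set α : ℝ := rcCriticalProb d q / 2 with hα
  have hα0 : 0 < α := by rw [hα]; linarith
  have hαpc : α < rcCriticalProb d q := by rw [hα]; linarith
  obtain ⟨βc, hβc, hP1, hP2⟩ := exists_threshold (d := d) (q := q) hd1 hq hα0 (by linarith : α ≤ p₁) hp₁
  have heq := threshold_eq_rcCriticalProb hd1 hq hα0 hαpc hpc hp₁ hβc hP1 hP2
  have hp₁I : p₁ ∈ Set.Ioo (0 : ℝ) 1 := ⟨hpc0.trans hpc, hp₁⟩
  refine ⟨(1 - regionWiredReal d p₁ q (box d (2 * 1)) (siteToBoundary d 1)) / 2,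
    by have := thetaBox_one_lt_one (d := d) hp₁I hq0; linarith, fun p hp => ?_⟩
  have hpI : p ∈ Set.Icc (0 : ℝ) 1 := ⟨(hpc0.trans hp.1).le, hp.2.trans hp₁.le⟩
  refine le_thetaWired_of_forall_le_thetaBox hpI hq fun m => ?_
  have h := hP2 p ⟨by rw [heq]; exact hp.1, hp.2⟩ m
  rwa [heq, proj_eq_self hpI] at h

end MonotonicOSSS

end Summit.CriticalPhenomena.PercolationContinuityZ3.Theorems.FK
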